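import Literature.AnabelianGeometry.SemiGraphs.PSCSeparatingCoveringsCutoffVertex
import Literature.AnabelianGeometry.SemiGraphs.PSCSeparatingCoveringsTwoComponentAffineEdges
import Literature.AnabelianGeometry.SemiGraphs.PSCUnrVerticialSeparatingCoveringsIrreducibleNodal
import Literature.AnabelianGeometry.SemiGraphs.PSCIrreducibleNodalCommTerminal
import Literature.AnabelianGeometry.SemiGraphs.PSCIrreducibleNodalOrigin
import Literature.GroupTheory.CombinatorialGroupTheory.PuncturedSurfaceGroupCuspBases
import HarnessLib

/-!
# [CombGC] Prop. 1.2, proof p. 9: ALL THREE separating coverings at IRREDUCIBLE ONE-NODAL data, and Prop. 1.2 (i)(ii) in full there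

Mochizuki, *A combinatorial version of the Grothendieck conjecture*, Tohoku Math. J. **59** (2007)
[CombGC] §1, PROOF of Proposition 1.2, p. 9 ("by gluing together appropriate finite étale coverings of the
anabelioids `G_v`, `G_e`, one may construct a finite étale covering `G' → G` [trivial over one vertex /
edge of a covering and nontrivial over another]") [cite: MochizukiCombGC2007, Prop 1.2 proof p.9], and
Proposition 1.2 (i)(ii) p. 8 [cite: MochizukiCombGC2007, Prop 1.2 pp.8-9].  Typed LEVEL-WISE by
abc-iut-w4-d081 as `PSCDatum.VerticialSeparatingCoverings` / `EdgeLikeSeparatingCoverings` /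
`UnrVerticialSeparatingCoverings` (rows P12-L01-V/E/U; abc-iut FACT-LIST rows F-2826 / F-2827 / F-2828,
conjunction F-2829 `SeparatingCoverings`; universal closures refuted, instance forms at genuine carriers
the content) and reduced to Prop. 1.2 (i)(ii) by abc-iut-w5-d183 (`prop12_of_separating`).

PROOF-ONLY file (abc-iut-w5-d174 gen 6), the sequel of `PSCIrreducibleNodalCommTerminal.lean`: the
carrier is abc-iut-f-164's IRREDUCIBLE ONE-NODAL shape (stratum `Δ_irr`, one vertex with a loop;
`ι : Γ_{g,r+1} → Π` a profinite pro-`Σ` completion, `g ≥ 1`; `Π_ν = cl ι⟨b_0⟩`, `Π_{c_j} = cl ι⟨c_j⟩`,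
`Π_v = cl ι⟨b_0, a_0 b_0 a_0⁻¹, a_i, b_i (i ≥ 1), c_j⟩`), where f-164 proved the `Π^unr` third F-2828
(`unrVerticialSeparatingCoverings_of_irreducibleNodal`).  Here:

* `verticialSeparatingCoverings_of_irreducibleNodal_affine` — **F-2826 at every irreducible one-nodal
  datum with `2 ≤ g ∨ 1 ≤ r`** (everything except the one-pointed nodal cubic `Γ_{1,1}`, as in f-164's
  Prop. 1.2 (i) file): with ONE vertex only same-vertex pairs of level vertices occur, and
  `Π_v = cl ι⟨b₀(X ∖ {a_0}) ∪ {a_0 b_0 a_0⁻¹}⟩` is exactly the CUT-OFF shape of abc-iut-f-164's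
  `cutoff_exists_open_separating_sameVertex` (`S = X ∖ {a_0}`, `E = {a_0 b_0 a_0⁻¹}`, `Ψ` the dual of a
  letter `a_1` or `c_1`);
* `edgeLikeSeparatingCoverings_of_irreducibleNodal_affine` — **F-2827 at every irreducible one-nodal datum
  with at least three cusps**: `b_0` and every `c_j` are members of free bases of `Γ_{g,r+1}`, so
  abc-iut-f-164's `edgeLikeSeparatingCoverings_of_rankOneFreeFactors` applies with the `ℤ/3`-characters
  `b_0^∨` and `δ_k − δ_m` (`exists_handleCuspCharacter`); three cusps are what abelian characters need to
  separate `c_0` from `c_k` (`∑_j χ(c_j) = 0`);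
* `separatingCoverings_of_irreducibleNodal_affine`, `prop12_of_irreducibleNodal_affine` — F-2829 (all three
  conjuncts) and hence ALL FIVE typed clauses of Prop. 1.2 (i)(ii) (including both sturdy `Π^unr`-clauses)
  at every such datum; `exists_irreducibleNodalDatum_prop12` — non-vacuity at the genuine pro-`Σ` datum of
  `PSCIrreducibleNodalOrigin.lean`.

HONEST SCOPE: `Γ` free (`r + 1 ≥ 1`); the edge-like third with one or two cusps wants a non-abelian
finite target for the cusp/cusp pairs and is not treated; the proper curve `Γ_{g,0}` is not treated.  A
shape instance is consistency evidence for the typed schemata, not the printed theorem for all pointed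
stable curves (cell FOUNDATIONS rows 13–14).  0 definitions; nothing here takes a side on [IUTchIII]
Cor. 3.12.
-/

noncomputable section

open scoped Pointwise

namespace Literature.AnabelianGeometry.SemiGraphs

namespace PSCDatum

open Literature.GroupTheory.CombinatorialGroupTheory
open Literature.GroupTheory.CombinatorialGroupTheory.PuncturedSurfaceGroup (a b c cuspInertia
  exists_freeGroupBasis_elim_zero exists_freeGroupBasis_eq_c exists_handleCuspCharacter)
open SemiGraphOfAnabelioids (IsProSigmaCompletion)
open SemiGraphOfAnabelioids.IsProSigmaCompletion (cutoff_exists_open_separating_sameVertex)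
open TwoComponentAffine (sum_twoDelta)
open Multiplicative

variable {P : Type} [Group P] [TopologicalSpace P] [IsTopologicalGroup P]
variable [CompactSpace P] [TotallyDisconnectedSpace P] {Sigma : Set ℕ} {g r : ℕ}

/-- `ofAdd 1 ≠ 1` in `ℤ/3`. [cite: MochizukiCombGC2007, Prop 1.2 proof p.9] -/
private theorem ofAdd_one_ne_one₃' : (ofAdd (1 : ZMod 3) : Multiplicative (ZMod 3)) ≠ 1 := by
  intro h
  have h1 : (1 : ZMod 3) = 0 := Multiplicative.ofAdd.injective (h.trans ofAdd_zero.symm)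
  exact absurd h1 (by decide)

/-- With three indices available there is one different from two given ones.
[cite: MochizukiCombGC2007, Prop 1.2 proof p.9] -/
private theorem exists_ne_ne' {n : ℕ} (hn : 3 ≤ n) (k₁ k₂ : Fin n) : ∃ m : Fin n, m ≠ k₁ ∧ m ≠ k₂ := by
  classical
  by_contra h
  push Not at h
  have hsub : (Finset.univ : Finset (Fin n)) ⊆ {k₁, k₂} := fun m _ => by
    rcases eq_or_ne m k₁ with h1 | h1
    · simp [h1]
    · simp [h m h1]
  have hcard := Finset.card_le_card hsub
  rw [Finset.card_univ, Fintype.card_fin] at hcard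
  have h2 : ({k₁, k₂} : Finset (Fin n)).card ≤ 2 := Finset.card_le_two
  omega

/-- With two indices available there is one different from a given one.
[cite: MochizukiCombGC2007, Prop 1.2 proof p.9] -/
private theorem exists_ne' {n : ℕ} (hn : 2 ≤ n) (k : Fin n) : ∃ m : Fin n, m ≠ k := by
  by_cases hk : (k : ℕ) = 0
  · exact ⟨⟨1, by omega⟩, fun h => by have := congrArg Fin.val h; simp only at this; omega⟩
  · exact ⟨⟨0, by omega⟩, fun h => by have := congrArg Fin.val h; simp only at this; omega⟩

/-! ### F-2826: the verticial separating coverings (one vertex: same-vertex pairs, cut-off twist) -/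

/-- **Row P12-L01-V / F-2826 (`VerticialSeparatingCoverings`) at EVERY irreducible one-nodal datum with
`2 ≤ g ∨ 1 ≤ r`.**  One vertex, so two distinct level vertices lie over the same vertex of `G`; the vertex
group `cl ι⟨b_0, a_0 b_0 a_0⁻¹, a_i, b_i (i ≥ 1), c_j⟩ = cl ι⟨b₀(y) (y ≠ a_0), a_0 b_0 a_0⁻¹⟩` is of
abc-iut-f-164's cut-off shape (`S = X ∖ {a_0}`, `E = {a_0 b_0 a_0⁻¹}`, `Ψ` = the dual character of `a_1` if
`g ≥ 2`, of `c_1` if `r ≥ 1` — it kills `a_0` and `b_0`), so `cutoff_exists_open_separating_sameVertex`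
separates them at the level `V` itself. [cite: MochizukiCombGC2007, Prop 1.2 proof p.9] -/
theorem verticialSeparatingCoverings_of_irreducibleNodal_affine (hne : Sigma.Nonempty)
    (hprime : ∀ p ∈ Sigma, p.Prime) (ι : PuncturedSurfaceGroup g (r + 1) →* P)
    (hι : IsProSigmaCompletion Sigma ι) (G : PSCDatum P) (hg : 1 ≤ g) (hgr : 2 ≤ g ∨ 1 ≤ r)
    (v₀ : G.graph.V) (hV : ∀ w, w = v₀)
    (hV₀ : G.vertGp v₀ = ((Subgroup.closure {x : PuncturedSurfaceGroup g (r + 1) |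
        x = PuncturedSurfaceGroup.b ⟨0, hg⟩ ∨
        x = PuncturedSurfaceGroup.a ⟨0, hg⟩ * PuncturedSurfaceGroup.b ⟨0, hg⟩ *
          (PuncturedSurfaceGroup.a ⟨0, hg⟩)⁻¹ ∨
        (∃ i : Fin g, 1 ≤ (i : ℕ) ∧ (x = PuncturedSurfaceGroup.a i ∨ x = PuncturedSurfaceGroup.b i)) ∨
        ∃ j : Fin (r + 1), x = PuncturedSurfaceGroup.c j}).map ι).topologicalClosure) :
    G.VerticialSeparatingCoverings := by
  classical
  obtain ⟨ℓ, hℓS⟩ := hne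
  have hℓ : ℓ.Prime := hprime ℓ hℓS
  obtain ⟨b₀, hba, hbb, hbc⟩ := exists_freeGroupBasis_elim_zero g r
  set t₀ : (Fin g × Bool) ⊕ Fin r := Sum.inl (⟨0, hg⟩, false) with ht₀
  -- the distinguished letter `i₀ ∈ S` carrying the character: `a_1` or `c_1`
  obtain ⟨i₀, hi₀t, hi₀b⟩ : ∃ i₀ : (Fin g × Bool) ⊕ Fin r, i₀ ≠ t₀ ∧ i₀ ≠ Sum.inl (⟨0, hg⟩, true) := by
    rcases hgr with hg2 | hr1
    · refine ⟨Sum.inl (⟨1, hg2⟩, false), ?_, ?_⟩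
      · rw [ht₀]; simp [Fin.ext_iff]
      · simp
    · exact ⟨Sum.inr ⟨0, hr1⟩, by rw [ht₀]; exact Sum.inr_ne_inl, Sum.inr_ne_inl⟩
  let Ψ : PuncturedSurfaceGroup g (r + 1) →* Multiplicative ℤ :=
    b₀.lift fun y => if y = i₀ then ofAdd (1 : ℤ) else 1
  have hΨ : ∀ y, Ψ (b₀ y) = if y = i₀ then ofAdd (1 : ℤ) else 1 := fun y => by
    change FreeGroup.lift _ (b₀.repr (b₀ y)) = _
    rw [FreeGroupBasis.repr_apply_coe, FreeGroup.lift_apply_of]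
  -- the cut-off data
  set S : Set ((Fin g × Bool) ⊕ Fin r) := {y | y ≠ t₀} with hSdef
  set E : Set (PuncturedSurfaceGroup g (r + 1)) :=
    {b₀ t₀ * b₀ (Sum.inl (⟨0, hg⟩, true)) * (b₀ t₀)⁻¹} with hEdef
  have hΨS : ∀ i, i ∉ S → Ψ (b₀ i) = 1 := fun i hi => by
    have hi' : i = t₀ := by
      by_contra h
      exact hi h
    rw [hΨ, if_neg (by rw [hi']; exact Ne.symm hi₀t)]
  have hEsub : E ⊆ Subgroup.closure (b₀ '' {i | i ∈ S → Ψ (b₀ i) = 1}) := by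
    rintro x hx
    rw [hEdef, Set.mem_singleton_iff] at hx
    subst hx
    have ht : b₀ t₀ ∈ Subgroup.closure (b₀ '' {i | i ∈ S → Ψ (b₀ i) = 1}) :=
      Subgroup.subset_closure ⟨t₀, fun h => absurd rfl h, rfl⟩
    have hb : b₀ (Sum.inl (⟨0, hg⟩, true)) ∈ Subgroup.closure (b₀ '' {i | i ∈ S → Ψ (b₀ i) = 1}) :=
      Subgroup.subset_closure ⟨_, fun _ => by rw [hΨ, if_neg (Ne.symm hi₀b)], rfl⟩
    exact Subgroup.mul_mem _ (Subgroup.mul_mem _ ht hb) (Subgroup.inv_mem _ ht)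
  have hi₀S : i₀ ∈ S := hi₀t
  have hΨi₀ : Ψ (b₀ i₀) ≠ 1 := by
    rw [hΨ, if_pos rfl]
    exact fun h => one_ne_zero (Multiplicative.ofAdd.injective (h.trans ofAdd_zero.symm))
  -- the vertex group in cut-off form
  have hAS : G.vertGp v₀ = ((Subgroup.closure (b₀ '' S ∪ E)).map ι).topologicalClosure := by
    rw [hV₀, irreducibleNodal_vertexClosure_eq hg b₀ hba hbb hbc]
    congr 3
    ext x
    simp only [hSdef, hEdef, Set.mem_union, Set.mem_setOf_eq, Set.mem_image, Set.mem_singleton_iff, ht₀]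
    constructor
    · rintro (⟨y, hy, rfl⟩ | rfl)
      · exact Or.inl ⟨y, hy, rfl⟩
      · exact Or.inr rfl
    · rintro (⟨y, hy, rfl⟩ | rfl)
      · exact Or.inl ⟨y, hy, rfl⟩
      · exact Or.inr rfl
  refine G.verticialSeparatingCoverings_of_sameVertex_of_crossVertex (fun V hVn hVo v γ₁ γ₂ hne12 => ?_)
    fun V _ _ v₁ v₂ _ _ h12 => absurd ((hV v₁).trans (hV v₂).symm) h12
  haveI := hVn
  rw [hV v] at hne12 ⊢
  exact cutoff_exists_open_separating_sameVertex hι b₀ S Ψ hΨS E hEsub _ rfl hi₀S hΨi₀ hℓ hℓS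
    (G.vertGp v₀) hAS V hVo γ₁ γ₂ hne12

/-! ### F-2827: the edge-like separating coverings (rank-one free factors, `ℤ/3`-characters) -/

/-- **Row P12-L01-E / F-2827 (`EdgeLikeSeparatingCoverings`) at EVERY irreducible one-nodal datum with at
least three cusps.**  The node loop `b_0` and every cusp generator `c_j` are members of free bases of
`Γ_{g,r+1}` (`exists_freeGroupBasis_elim_zero`, `exists_freeGroupBasis_eq_c`), so abc-iut-f-164's
`edgeLikeSeparatingCoverings_of_rankOneFreeFactors` applies; the separating characters into `ℤ/3` are
`b_0^∨` (alive node, killed cusp), `δ_k − δ_m` with `m ≠ k` (alive cusp `c_k`, killed node) and `δ_k − δ_m`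
with `m ∉ {k, k'}` (alive `c_k`, killed `c_{k'}` — this is where three cusps are used).
[cite: MochizukiCombGC2007, Prop 1.2 proof p.9] -/
theorem edgeLikeSeparatingCoverings_of_irreducibleNodal_affine (hne : Sigma.Nonempty)
    (hprime : ∀ p ∈ Sigma, p.Prime) (ι : PuncturedSurfaceGroup g (r + 1) →* P)
    (hι : IsProSigmaCompletion Sigma ι) (G : PSCDatum P) (hg : 1 ≤ g) (hr : 2 ≤ r)
    (e : G.graph.C ≃ Fin (r + 1))
    (hC : ∀ c', G.cuspGp c' = ((cuspInertia (g := g) (e c')).map ι).topologicalClosure)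
    (n₀ : G.graph.N) (hN : ∀ n, n = n₀)
    (hE : G.nodeGp n₀ = ((Subgroup.zpowers (PuncturedSurfaceGroup.b (r := r + 1) (⟨0, hg⟩ : Fin g))).map
      ι).topologicalClosure) :
    G.EdgeLikeSeparatingCoverings := by
  classical
  have hSig : ∃ ℓ ∈ Sigma, ℓ.Prime := hne.imp fun p hp => ⟨hp, hprime p hp⟩
  obtain ⟨b₀, -, hbb, -⟩ := exists_freeGroupBasis_elim_zero g r
  -- generators of the edge groups
  let xs : G.graph.N ⊕ G.graph.C → PuncturedSurfaceGroup g (r + 1) :=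
    Sum.elim (fun _ => b ⟨0, hg⟩) fun c' => c (e c')
  have hxn : ∀ n, xs (Sum.inl n) = b ⟨0, hg⟩ := fun _ => rfl
  have hxc : ∀ c', xs (Sum.inr c') = c (e c') := fun _ => rfl
  have hx : ∀ e', G.edgeGp e' = ((Subgroup.zpowers (xs e')).map ι).topologicalClosure := by
    rintro (n | c')
    · change G.nodeGp n = _
      rw [hN n, hE, hxn]
    · exact hC c'
  have hfac : ∀ e', ∃ (κ : Type) (bκ : FreeGroupBasis κ (PuncturedSurfaceGroup g (r + 1))) (k : κ),
      bκ k = xs e' := by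
    rintro (n | c')
    · exact ⟨_, b₀, Sum.inl (⟨0, hg⟩, true), by rw [hxn]; exact hbb _⟩
    · obtain ⟨β, bs, k, hk⟩ := exists_freeGroupBasis_eq_c (g := g) (by omega : 2 ≤ r + 1) (e c')
      exact ⟨β, bs, k, hk⟩
  -- the separating characters
  have hsep : ∀ e₁ e₂, e₁ ≠ e₂ → ∃ χ : PuncturedSurfaceGroup g (r + 1) →* Multiplicative (ZMod 3),
      χ (xs e₂) = 1 ∧ χ (xs e₁) ≠ 1 := by
    rintro (n₁ | c₁) (n₂ | c₂) hne12
    · exact absurd (by rw [hN n₁, hN n₂]) hne12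
    · -- alive node `b_0`, killed cusp: the dual character of `b_0`
      obtain ⟨χ, -, hχb, hχc⟩ := exists_handleCuspCharacter (g := g) (r := r + 1) (n := 3) (fun _ => 0)
        (fun i => if i = ⟨0, hg⟩ then 1 else 0) (fun _ => 0) (by simp)
      refine ⟨χ, ?_, ?_⟩
      · rw [hxc, hχc, ofAdd_zero]
      · rw [hxn, hχb, if_pos rfl]
        exact ofAdd_one_ne_one₃'
    · -- alive cusp `c_{k₁}`, killed node: `δ_{k₁} − δ_m`, `m ≠ k₁`
      set k₁ := e c₁ with hk₁
      obtain ⟨m, hm⟩ := exists_ne' (by omega : 2 ≤ r + 1) k₁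
      obtain ⟨χ, -, hχb, hχc⟩ := exists_handleCuspCharacter (g := g) (r := r + 1) (n := 3) (fun _ => 0)
        (fun _ => 0) (fun j => (if j = k₁ then (1 : ZMod 3) else 0) + (if j = m then (-1 : ZMod 3) else 0))
        (sum_twoDelta k₁ m)
      refine ⟨χ, ?_, ?_⟩
      · rw [hxn, hχb, ofAdd_zero]
      · rw [hxc, hχc, if_pos rfl, if_neg (Ne.symm hm), add_zero]
        exact ofAdd_one_ne_one₃'
    · -- alive cusp `c_{k₁}`, killed cusp `c_{k₂}`: `δ_{k₁} − δ_m`, `m ∉ {k₁, k₂}`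
      set k₁ := e c₁ with hk₁
      set k₂ := e c₂ with hk₂
      have hk : k₁ ≠ k₂ := fun h => hne12 (by rw [e.injective h])
      obtain ⟨m, hm1, hm2⟩ := exists_ne_ne' (by omega : 3 ≤ r + 1) k₁ k₂
      obtain ⟨χ, -, -, hχc⟩ := exists_handleCuspCharacter (g := g) (r := r + 1) (n := 3) (fun _ => 0)
        (fun _ => 0) (fun j => (if j = k₁ then (1 : ZMod 3) else 0) + (if j = m then (-1 : ZMod 3) else 0))
        (sum_twoDelta k₁ m)
      refine ⟨χ, ?_, ?_⟩
      · rw [hxc, hχc, if_neg (Ne.symm hk), if_neg (Ne.symm hm2), add_zero, ofAdd_zero]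
      · rw [hxc, hχc, if_pos rfl, if_neg (Ne.symm hm1), add_zero]
        exact ofAdd_one_ne_one₃'
  exact edgeLikeSeparatingCoverings_of_rankOneFreeFactors hι hSig G xs hx hfac hsep

/-! ### F-2829 and Prop. 1.2 (i)(ii) in full -/

/-- **F-2829 (`SeparatingCoverings`, all three conjuncts) at EVERY irreducible one-nodal datum with
`g ≥ 1` and at least three cusps** (F-2826 and F-2827 above; the `Π^unr` third is abc-iut-f-164's
`unrVerticialSeparatingCoverings_of_irreducibleNodal`). [cite: MochizukiCombGC2007, Prop 1.2 proof p.9] -/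
theorem separatingCoverings_of_irreducibleNodal_affine (hne : Sigma.Nonempty)
    (hprime : ∀ p ∈ Sigma, p.Prime) (ι : PuncturedSurfaceGroup g (r + 1) →* P)
    (hι : IsProSigmaCompletion Sigma ι) (G : PSCDatum P) (hg : 1 ≤ g) (hr : 2 ≤ r)
    (e : G.graph.C ≃ Fin (r + 1))
    (hC : ∀ c', G.cuspGp c' = ((cuspInertia (g := g) (e c')).map ι).topologicalClosure)
    (v₀ : G.graph.V) (hV : ∀ w, w = v₀) (n₀ : G.graph.N) (hN : ∀ n, n = n₀)
    (hE : G.nodeGp n₀ = ((Subgroup.zpowers (PuncturedSurfaceGroup.b (r := r + 1) (⟨0, hg⟩ : Fin g))).map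
      ι).topologicalClosure)
    (hV₀ : G.vertGp v₀ = ((Subgroup.closure {x : PuncturedSurfaceGroup g (r + 1) |
        x = PuncturedSurfaceGroup.b ⟨0, hg⟩ ∨
        x = PuncturedSurfaceGroup.a ⟨0, hg⟩ * PuncturedSurfaceGroup.b ⟨0, hg⟩ *
          (PuncturedSurfaceGroup.a ⟨0, hg⟩)⁻¹ ∨
        (∃ i : Fin g, 1 ≤ (i : ℕ) ∧ (x = PuncturedSurfaceGroup.a i ∨ x = PuncturedSurfaceGroup.b i)) ∨
        ∃ j : Fin (r + 1), x = PuncturedSurfaceGroup.c j}).map ι).topologicalClosure)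
    (hgen : G.genus v₀ = g - 1) : G.SeparatingCoverings :=
  ⟨G.verticialSeparatingCoverings_of_irreducibleNodal_affine hne hprime ι hι hg (Or.inr (by omega)) v₀ hV hV₀,
    G.edgeLikeSeparatingCoverings_of_irreducibleNodal_affine hne hprime ι hι hg hr e hC n₀ hN hE,
    G.unrVerticialSeparatingCoverings_of_irreducibleNodal hne hprime ι hι hg e hC v₀ hV n₀ hN hE hV₀ hgen⟩

/-- **[CombGC] Prop. 1.2 (i) and (ii), ALL FIVE typed clauses, at EVERY irreducible one-nodal datum with
`g ≥ 1` and at least three cusps**: `VerticialOpenInterDeterminesVertex`, `EdgeLikeOpenInterDeterminesEdge`,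
`UnrVerticialOpenInterDeterminesVertex` (Prop. 1.2 (i)) and `VerticialEdgeLikeCommensurablyTerminal`,
`UnrVerticialCommensurablyTerminal` (Prop. 1.2 (ii)) — abc-iut-w5-d183's reduction `prop12_of_separating`
applied to `separatingCoverings_of_irreducibleNodal_affine`. [cite: MochizukiCombGC2007, Prop 1.2 pp.8-9] -/
theorem prop12_of_irreducibleNodal_affine (hne : Sigma.Nonempty)
    (hprime : ∀ p ∈ Sigma, p.Prime) (ι : PuncturedSurfaceGroup g (r + 1) →* P)
    (hι : IsProSigmaCompletion Sigma ι) (G : PSCDatum P) (hg : 1 ≤ g) (hr : 2 ≤ r)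
    (e : G.graph.C ≃ Fin (r + 1))
    (hC : ∀ c', G.cuspGp c' = ((cuspInertia (g := g) (e c')).map ι).topologicalClosure)
    (v₀ : G.graph.V) (hV : ∀ w, w = v₀) (n₀ : G.graph.N) (hN : ∀ n, n = n₀)
    (hE : G.nodeGp n₀ = ((Subgroup.zpowers (PuncturedSurfaceGroup.b (r := r + 1) (⟨0, hg⟩ : Fin g))).map
      ι).topologicalClosure)
    (hV₀ : G.vertGp v₀ = ((Subgroup.closure {x : PuncturedSurfaceGroup g (r + 1) |
        x = PuncturedSurfaceGroup.b ⟨0, hg⟩ ∨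
        x = PuncturedSurfaceGroup.a ⟨0, hg⟩ * PuncturedSurfaceGroup.b ⟨0, hg⟩ *
          (PuncturedSurfaceGroup.a ⟨0, hg⟩)⁻¹ ∨
        (∃ i : Fin g, 1 ≤ (i : ℕ) ∧ (x = PuncturedSurfaceGroup.a i ∨ x = PuncturedSurfaceGroup.b i)) ∨
        ∃ j : Fin (r + 1), x = PuncturedSurfaceGroup.c j}).map ι).topologicalClosure)
    (hgen : G.genus v₀ = g - 1) :
    (G.VerticialOpenInterDeterminesVertex ∧ G.EdgeLikeOpenInterDeterminesEdge ∧
      G.UnrVerticialOpenInterDeterminesVertex) ∧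
    (G.VerticialEdgeLikeCommensurablyTerminal ∧ G.UnrVerticialCommensurablyTerminal) :=
  G.prop12_of_separating
    (G.separatingCoverings_of_irreducibleNodal_affine hne hprime ι hι hg hr e hC v₀ hV n₀ hN hE hV₀ hgen)

/-- **Non-vacuity at a genuine datum**: over any nonempty set of primes `Σ` there is an irreducible one-nodal
datum (`g = 1`, three cusps: the pro-`Σ` completion of `Γ_{1,3}` of `PSCIrreducibleNodalOrigin.lean`) at
which F-2829 and all five clauses of Prop. 1.2 (i)(ii) hold. [cite: MochizukiCombGC2007, Prop 1.2 pp.8-9] -/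
theorem exists_irreducibleNodalDatum_prop12 (Sigma : Set ℕ) (hne : Sigma.Nonempty)
    (hprime : ∀ p ∈ Sigma, p.Prime) :
    ∃ (Q : ProfiniteGrp.{0}) (ι : PuncturedSurfaceGroup 1 3 →* Q) (G : PSCDatum Q),
      IsProSigmaCompletion Sigma ι ∧ G.Sigma = Sigma ∧ G.graph.i = 1 ∧ G.graph.n = 1 ∧ G.graph.r = 3 ∧
      G.SeparatingCoverings ∧
      (G.VerticialOpenInterDeterminesVertex ∧ G.EdgeLikeOpenInterDeterminesEdge ∧
        G.UnrVerticialOpenInterDeterminesVertex) ∧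
      (G.VerticialEdgeLikeCommensurablyTerminal ∧ G.UnrVerticialCommensurablyTerminal) := by
  obtain ⟨Q, ι, G, e, v₀, n₀, hι, hS, hi, hn, hr, hC, hV, hN, hE, hV₀, hgen, -⟩ :=
    exists_irreducibleNodalDatum Sigma hne hprime 1 3 le_rfl
  have hsep := G.separatingCoverings_of_irreducibleNodal_affine hne hprime ι hι le_rfl le_rfl e hC v₀ hV n₀
    hN hE hV₀ hgen
  exact ⟨Q, ι, G, hι, hS, hi, hn, hr, hsep, G.prop12_of_separating hsep⟩

end PSCDatum

end Literature.AnabelianGeometry.SemiGraphs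

end
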